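import Mathlib.Data.Nat.Dist
import Summits.AtomisticToContinuum.FouriersLaw.Theorems.HeatModeWeylLawSpecificHeatLimitCovariance
import HarnessLib

/-!
# Transfer-operator covariances, II: off-diagonal / diagonal decay and bulk-limit estimates

Helper file for item `stmt-AtomisticToContinuum-12398` (`SpecificHeatLimit`, route `HeatModeWeylLaw`
of `AtomisticToContinuum/FouriersLaw`); continuation of
`HeatModeWeylLawSpecificHeatLimitCovariance.lean` (determinant decay `abs_det_le`, ratio convergence
`abs_ratio_sub_le`). For the normalised transfer operator `At` (`At φ = φ`,
`‖Atʲ g - ⟪φ, g⟫ φ‖ ≤ rʲ ‖g‖`) and bounded insertions `H` (symmetric), `H₂`: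

* `offdiag_decay`, `offdiag_limit` — the covariance of two bond observables at distance `g + 1`,
  `T₁/(λ²T₄) - (T₂/(λT₄))(T₃/(λT₄))`, is `O(rᵍ⁺¹)` uniformly in the boundary iterates and converges
  to `(⟪φ, H Atᵍ H φ⟫ - ⟪φ, Hφ⟫²)/λ²` at rate `δu + δw` as the boundaries recede;
* `diag_decay`, `diag_limit` — the same for the diagonal (variance) terms with `H₂`;
* `abs_bulkCov_le` — the bulk covariances are `O(rᵍ⁺¹)`.

All [folklore]; no definitions.
-/

noncomputable section

open Filter Topology
open scoped RealInnerProductSpace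

namespace Summit.AtomisticToContinuum.FouriersLaw.Theorems.SpecificHeatLimit

open Literature.Analysis.OperatorTheory

/-! ### Off-diagonal and diagonal covariance bounds (normalised operator) -/

section Bounds

variable {E : Type*} [NormedAddCommGroup E] [InnerProductSpace ℝ E]
  {At H H₂ : E →L[ℝ] E} {φ : E} {r : ℝ}

/-- **Off-diagonal decay.** With `T₄ = ⟪u, Atᵍ⁺² w⟫ ≥ z_* > 0` and `‖u‖, ‖w‖ ≤ U`, the normalised
covariance `T₁/(λ²T₄) - (T₂/(λT₄))(T₃/(λT₄))` is bounded by `12 ‖H‖² U⁴/(λ² z_*²) · rᵍ⁺¹`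
(`r ≥ 1/2`). [folklore] -/
theorem offdiag_decay (hφ : ‖φ‖ = 1) (hr0 : 0 ≤ r) (hr1 : r ≤ 1) (hrhalf : 1 / 2 ≤ r)
    (hpow : ∀ (j : ℕ) (g : E), ‖(At ^ j) g - ⟪φ, g⟫ • φ‖ ≤ r ^ j * ‖g‖)
    {u w : E} {U zs lam : ℝ} (hlam : 0 < lam) (hzs : 0 < zs) (hu : ‖u‖ ≤ U) (hw : ‖w‖ ≤ U)
    (g : ℕ) (hT : zs ≤ ⟪u, (At ^ (g + 2)) w⟫) :
    |⟪u, H ((At ^ g) (H w))⟫ / (lam ^ 2 * ⟪u, (At ^ (g + 2)) w⟫) -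
        ⟪u, H ((At ^ (g + 1)) w)⟫ / (lam * ⟪u, (At ^ (g + 2)) w⟫) *
          (⟪u, (At ^ (g + 1)) (H w)⟫ / (lam * ⟪u, (At ^ (g + 2)) w⟫))| ≤
      12 * ‖H‖ ^ 2 * U ^ 4 / (lam ^ 2 * zs ^ 2) * r ^ (g + 1) := by
  have hT0 : 0 < ⟪u, (At ^ (g + 2)) w⟫ := hzs.trans_le hT
  have hU : 0 ≤ U := (norm_nonneg _).trans hu
  have hdet := abs_det_le (H := H) hφ hr0 hr1 hpow g u w
  have hrshift : r ^ g ≤ 2 * r ^ (g + 1) := by rw [pow_succ]; nlinarith [pow_nonneg hr0 g]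
  have e : ⟪u, H ((At ^ g) (H w))⟫ / (lam ^ 2 * ⟪u, (At ^ (g + 2)) w⟫) -
      ⟪u, H ((At ^ (g + 1)) w)⟫ / (lam * ⟪u, (At ^ (g + 2)) w⟫) *
        (⟪u, (At ^ (g + 1)) (H w)⟫ / (lam * ⟪u, (At ^ (g + 2)) w⟫)) =
      (⟪u, H ((At ^ g) (H w))⟫ * ⟪u, (At ^ (g + 2)) w⟫ -
        ⟪u, H ((At ^ (g + 1)) w)⟫ * ⟪u, (At ^ (g + 1)) (H w)⟫) /
        (lam ^ 2 * ⟪u, (At ^ (g + 2)) w⟫ ^ 2) := by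
    field_simp
  rw [e, abs_div, abs_of_pos (by positivity : 0 < lam ^ 2 * ⟪u, (At ^ (g + 2)) w⟫ ^ 2)]
  calc |⟪u, H ((At ^ g) (H w))⟫ * ⟪u, (At ^ (g + 2)) w⟫ -
        ⟪u, H ((At ^ (g + 1)) w)⟫ * ⟪u, (At ^ (g + 1)) (H w)⟫| /
        (lam ^ 2 * ⟪u, (At ^ (g + 2)) w⟫ ^ 2)
      ≤ 6 * ‖H‖ ^ 2 * ‖u‖ ^ 2 * ‖w‖ ^ 2 * r ^ g / (lam ^ 2 * zs ^ 2) := by gcongr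
    _ ≤ 6 * ‖H‖ ^ 2 * U ^ 2 * U ^ 2 * (2 * r ^ (g + 1)) / (lam ^ 2 * zs ^ 2) := by gcongr
    _ = 12 * ‖H‖ ^ 2 * U ^ 4 / (lam ^ 2 * zs ^ 2) * r ^ (g + 1) := by ring

/-- **Off-diagonal bulk convergence.** For boundary iterates `u, w` within `δu, δw` of `cφ`, the
normalised covariance is within `C (δu + δw)` of its bulk value
`(⟪φ, H Atᵍ H φ⟫ - ⟪φ, Hφ⟫²)/λ²`, with `C` independent of the distance `g`. [folklore] -/
theorem offdiag_limit (hφ : ‖φ‖ = 1) (hr0 : 0 ≤ r) (hr1 : r ≤ 1)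
    (hpow : ∀ (j : ℕ) (g : E), ‖(At ^ j) g - ⟪φ, g⟫ • φ‖ ≤ r ^ j * ‖g‖) (hAtφ : At φ = φ)
    (hsym : ∀ x y : E, ⟪At x, y⟫ = ⟪x, At y⟫)
    {u w : E} {c δu δw U zs lam : ℝ} (hlam : 0 < lam) (hzs : 0 < zs)
    (hδu : ‖u - c • φ‖ ≤ δu) (hδw : ‖w - c • φ‖ ≤ δw) (hu : ‖u‖ ≤ U) (hw : ‖w‖ ≤ U)
    (hc : |c| ≤ U) (hzc : zs ≤ c ^ 2) (g : ℕ) (hT : zs ≤ ⟪u, (At ^ (g + 2)) w⟫) :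
    |⟪u, H ((At ^ g) (H w))⟫ / (lam ^ 2 * ⟪u, (At ^ (g + 2)) w⟫) -
        ⟪u, H ((At ^ (g + 1)) w)⟫ / (lam * ⟪u, (At ^ (g + 2)) w⟫) *
          (⟪u, (At ^ (g + 1)) (H w)⟫ / (lam * ⟪u, (At ^ (g + 2)) w⟫)) -
        (⟪φ, H ((At ^ g) (H φ))⟫ - ⟪φ, H φ⟫ ^ 2) / lam ^ 2| ≤
      ((2 * ‖H‖ ^ 2 * U / zs + U ^ 2 * (2 * ‖H‖ ^ 2) * (2 * U) / zs ^ 2) +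
        (2 * ‖H‖ * U / zs + U ^ 2 * (2 * ‖H‖) * (2 * U) / zs ^ 2) * (2 * ‖H‖ * U ^ 2 / zs) +
        ‖H‖ * (2 * ‖H‖ * U / zs + U ^ 2 * (2 * ‖H‖) * (2 * U) / zs ^ 2)) / lam ^ 2 *
        (δu + δw) := by
  set T₄ := ⟪u, (At ^ (g + 2)) w⟫ with hT₄
  set η := ⟪φ, H φ⟫ with hη
  have hT0 : 0 < T₄ := hzs.trans_le hT
  have hU : 0 ≤ U := (norm_nonneg _).trans hu
  have hδu0 : 0 ≤ δu := (norm_nonneg _).trans hδu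
  have hδw0 : 0 ≤ δw := (norm_nonneg _).trans hδw
  have hηb : |η| ≤ ‖H‖ := by
    calc |η| ≤ ‖φ‖ * ‖H φ‖ := abs_real_inner_le_norm _ _
      _ ≤ ‖φ‖ * (‖H‖ * ‖φ‖) := by gcongr; exact H.le_opNorm φ
      _ = ‖H‖ := by rw [hφ]; ring
  have hAtg : ∀ j, ‖At ^ j‖ ≤ 2 := fun j => norm_pow_le_two hφ hr0 hr1 hpow j
  have hM1 : ‖H * (At ^ g * H)‖ ≤ 2 * ‖H‖ ^ 2 :=
    calc ‖H * (At ^ g * H)‖ ≤ ‖H‖ * ‖At ^ g * H‖ := norm_mul_le _ _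
      _ ≤ ‖H‖ * (‖At ^ g‖ * ‖H‖) := by gcongr; exact norm_mul_le _ _
      _ ≤ ‖H‖ * (2 * ‖H‖) := by gcongr; exact hAtg g
      _ = 2 * ‖H‖ ^ 2 := by ring
  have hM2 : ‖H * At ^ (g + 1)‖ ≤ 2 * ‖H‖ :=
    calc ‖H * At ^ (g + 1)‖ ≤ ‖H‖ * ‖At ^ (g + 1)‖ := norm_mul_le _ _
      _ ≤ ‖H‖ * 2 := by gcongr; exact hAtg _
      _ = 2 * ‖H‖ := by ring
  have hM3 : ‖At ^ (g + 1) * H‖ ≤ 2 * ‖H‖ :=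
    calc ‖At ^ (g + 1) * H‖ ≤ ‖At ^ (g + 1)‖ * ‖H‖ := norm_mul_le _ _
      _ ≤ 2 * ‖H‖ := by gcongr; exact hAtg _
  -- the three ratios
  have h1 : |⟪u, H ((At ^ g) (H w))⟫ / T₄ - ⟪φ, H ((At ^ g) (H φ))⟫| ≤
      (2 * ‖H‖ ^ 2 * U / zs + U ^ 2 * (2 * ‖H‖ ^ 2) * (2 * U) / zs ^ 2) * (δu + δw) := by
    have h := abs_ratio_sub_le hφ hr0 hr1 hpow hAtφ hM1 (g + 2) hzs hδu hδw hu hw hc hzc hT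
    simp only [mul_apply_eq_comp] at h
    exact h
  have h2 : |⟪u, H ((At ^ (g + 1)) w)⟫ / T₄ - η| ≤
      (2 * ‖H‖ * U / zs + U ^ 2 * (2 * ‖H‖) * (2 * U) / zs ^ 2) * (δu + δw) := by
    have h := abs_ratio_sub_le hφ hr0 hr1 hpow hAtφ hM2 (g + 2) hzs hδu hδw hu hw hc hzc hT
    simp only [mul_apply_eq_comp, pow_apply_eq_self hAtφ] at h
    exact h
  have h3 : |⟪u, (At ^ (g + 1)) (H w)⟫ / T₄ - η| ≤
      (2 * ‖H‖ * U / zs + U ^ 2 * (2 * ‖H‖) * (2 * U) / zs ^ 2) * (δu + δw) := by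
    have h := abs_ratio_sub_le hφ hr0 hr1 hpow hAtφ hM3 (g + 2) hzs hδu hδw hu hw hc hzc hT
    simp only [mul_apply_eq_comp] at h
    rw [← inner_pow_apply_comm hsym (g + 1) φ (H φ), pow_apply_eq_self hAtφ] at h
    exact h
  have h3b : |⟪u, (At ^ (g + 1)) (H w)⟫ / T₄| ≤ 2 * ‖H‖ * U ^ 2 / zs := by
    have h := abs_ratio_le hM3 hzs hu hw hT
    simp only [mul_apply_eq_comp] at h
    exact h
  have e : ⟪u, H ((At ^ g) (H w))⟫ / (lam ^ 2 * T₄) -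
      ⟪u, H ((At ^ (g + 1)) w)⟫ / (lam * T₄) * (⟪u, (At ^ (g + 1)) (H w)⟫ / (lam * T₄)) -
      (⟪φ, H ((At ^ g) (H φ))⟫ - η ^ 2) / lam ^ 2 =
      ((⟪u, H ((At ^ g) (H w))⟫ / T₄ - ⟪φ, H ((At ^ g) (H φ))⟫) -
        ((⟪u, H ((At ^ (g + 1)) w)⟫ / T₄ - η) * (⟪u, (At ^ (g + 1)) (H w)⟫ / T₄) +
          η * (⟪u, (At ^ (g + 1)) (H w)⟫ / T₄ - η))) / lam ^ 2 := by
    field_simp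
    ring
  rw [e, abs_div, abs_of_pos (pow_pos hlam 2), div_mul_eq_mul_div]
  refine div_le_div_of_nonneg_right ?_ (pow_pos hlam 2).le
  have hK2 : 0 ≤ (2 * ‖H‖ * U / zs + U ^ 2 * (2 * ‖H‖) * (2 * U) / zs ^ 2) := by positivity
  calc |(⟪u, H ((At ^ g) (H w))⟫ / T₄ - ⟪φ, H ((At ^ g) (H φ))⟫) -
        ((⟪u, H ((At ^ (g + 1)) w)⟫ / T₄ - η) * (⟪u, (At ^ (g + 1)) (H w)⟫ / T₄) +
          η * (⟪u, (At ^ (g + 1)) (H w)⟫ / T₄ - η))|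
      ≤ |⟪u, H ((At ^ g) (H w))⟫ / T₄ - ⟪φ, H ((At ^ g) (H φ))⟫| +
        (|⟪u, H ((At ^ (g + 1)) w)⟫ / T₄ - η| * |⟪u, (At ^ (g + 1)) (H w)⟫ / T₄| +
          |η| * |⟪u, (At ^ (g + 1)) (H w)⟫ / T₄ - η|) := by
        refine (abs_sub _ _).trans (add_le_add le_rfl ((abs_add_le _ _).trans ?_))
        rw [abs_mul, abs_mul]
    _ ≤ (2 * ‖H‖ ^ 2 * U / zs + U ^ 2 * (2 * ‖H‖ ^ 2) * (2 * U) / zs ^ 2) * (δu + δw) +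
        ((2 * ‖H‖ * U / zs + U ^ 2 * (2 * ‖H‖) * (2 * U) / zs ^ 2) * (δu + δw) *
          (2 * ‖H‖ * U ^ 2 / zs) +
          ‖H‖ * ((2 * ‖H‖ * U / zs + U ^ 2 * (2 * ‖H‖) * (2 * U) / zs ^ 2) * (δu + δw))) := by
        gcongr
    _ = _ := by ring

/-- **Diagonal bound.** With `T = ⟪u, At w⟫ ≥ z_* > 0` and `‖u‖, ‖w‖ ≤ U`:
`|⟪u, H₂w⟫/(λT) - (⟪u, Hw⟫/(λT))²| ≤ ‖H₂‖U²/(z_*λ) + (‖H‖U²/z_*)²/λ²`. [folklore] -/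
theorem diag_decay {u w : E} {U zs lam : ℝ} (hlam : 0 < lam) (hzs : 0 < zs) (hu : ‖u‖ ≤ U)
    (hw : ‖w‖ ≤ U) (hT : zs ≤ ⟪u, (At ^ 1) w⟫) :
    |⟪u, H₂ w⟫ / (lam * ⟪u, (At ^ 1) w⟫) -
        ⟪u, H w⟫ / (lam * ⟪u, (At ^ 1) w⟫) * (⟪u, H w⟫ / (lam * ⟪u, (At ^ 1) w⟫))| ≤
      ‖H₂‖ * U ^ 2 / zs / lam + (‖H‖ * U ^ 2 / zs) ^ 2 / lam ^ 2 := by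
  set T₄ := ⟪u, (At ^ 1) w⟫ with hT₄
  have hT0 : 0 < T₄ := hzs.trans_le hT
  have hD : |⟪u, H₂ w⟫ / T₄| ≤ ‖H₂‖ * U ^ 2 / zs := abs_ratio_le le_rfl hzs hu hw hT
  have hT' : |⟪u, H w⟫ / T₄| ≤ ‖H‖ * U ^ 2 / zs := abs_ratio_le le_rfl hzs hu hw hT
  have e : ⟪u, H₂ w⟫ / (lam * T₄) - ⟪u, H w⟫ / (lam * T₄) * (⟪u, H w⟫ / (lam * T₄)) =
      (⟪u, H₂ w⟫ / T₄) / lam - (⟪u, H w⟫ / T₄) ^ 2 / lam ^ 2 := by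
    field_simp
  rw [e]
  calc |⟪u, H₂ w⟫ / T₄ / lam - (⟪u, H w⟫ / T₄) ^ 2 / lam ^ 2|
      ≤ |⟪u, H₂ w⟫ / T₄ / lam| + |(⟪u, H w⟫ / T₄) ^ 2 / lam ^ 2| := abs_sub _ _
    _ = |⟪u, H₂ w⟫ / T₄| / lam + |⟪u, H w⟫ / T₄| ^ 2 / lam ^ 2 := by
        rw [abs_div _ lam, abs_div _ (lam ^ 2), abs_of_pos hlam, abs_of_pos (pow_pos hlam 2),
          pow_abs]
    _ ≤ ‖H₂‖ * U ^ 2 / zs / lam + (‖H‖ * U ^ 2 / zs) ^ 2 / lam ^ 2 := by gcongr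

/-- **Diagonal bulk convergence.** For boundary iterates `u, w` within `δu, δw` of `cφ`, the
normalised variance term is within `C (δu + δw)` of `⟪φ, H₂φ⟫/λ - (⟪φ, Hφ⟫/λ)²`. [folklore] -/
theorem diag_limit (hφ : ‖φ‖ = 1) (hr0 : 0 ≤ r) (hr1 : r ≤ 1)
    (hpow : ∀ (j : ℕ) (g : E), ‖(At ^ j) g - ⟪φ, g⟫ • φ‖ ≤ r ^ j * ‖g‖) (hAtφ : At φ = φ)
    {u w : E} {c δu δw U zs lam : ℝ} (hlam : 0 < lam) (hzs : 0 < zs)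
    (hδu : ‖u - c • φ‖ ≤ δu) (hδw : ‖w - c • φ‖ ≤ δw) (hu : ‖u‖ ≤ U) (hw : ‖w‖ ≤ U)
    (hc : |c| ≤ U) (hzc : zs ≤ c ^ 2) (hT : zs ≤ ⟪u, (At ^ 1) w⟫) :
    |⟪u, H₂ w⟫ / (lam * ⟪u, (At ^ 1) w⟫) -
        ⟪u, H w⟫ / (lam * ⟪u, (At ^ 1) w⟫) * (⟪u, H w⟫ / (lam * ⟪u, (At ^ 1) w⟫)) -
        (⟪φ, H₂ φ⟫ / lam - (⟪φ, H φ⟫ / lam) ^ 2)| ≤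
      ((‖H₂‖ * U / zs + U ^ 2 * ‖H₂‖ * (2 * U) / zs ^ 2) / lam +
        (‖H‖ * U ^ 2 / zs + ‖H‖) * (‖H‖ * U / zs + U ^ 2 * ‖H‖ * (2 * U) / zs ^ 2) / lam ^ 2) *
        (δu + δw) := by
  set T₄ := ⟪u, (At ^ 1) w⟫ with hT₄
  set η := ⟪φ, H φ⟫ with hη
  have hT0 : 0 < T₄ := hzs.trans_le hT
  have hU : 0 ≤ U := (norm_nonneg _).trans hu
  have hδu0 : 0 ≤ δu := (norm_nonneg _).trans hδu
  have hδw0 : 0 ≤ δw := (norm_nonneg _).trans hδw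
  have hηb : |η| ≤ ‖H‖ := by
    calc |η| ≤ ‖φ‖ * ‖H φ‖ := abs_real_inner_le_norm _ _
      _ ≤ ‖φ‖ * (‖H‖ * ‖φ‖) := by gcongr; exact H.le_opNorm φ
      _ = ‖H‖ := by rw [hφ]; ring
  have h1 : |⟪u, H₂ w⟫ / T₄ - ⟪φ, H₂ φ⟫| ≤
      (‖H₂‖ * U / zs + U ^ 2 * ‖H₂‖ * (2 * U) / zs ^ 2) * (δu + δw) :=
    abs_ratio_sub_le hφ hr0 hr1 hpow hAtφ le_rfl 1 hzs hδu hδw hu hw hc hzc hT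
  have h2 : |⟪u, H w⟫ / T₄ - η| ≤ (‖H‖ * U / zs + U ^ 2 * ‖H‖ * (2 * U) / zs ^ 2) * (δu + δw) :=
    abs_ratio_sub_le hφ hr0 hr1 hpow hAtφ le_rfl 1 hzs hδu hδw hu hw hc hzc hT
  have hT' : |⟪u, H w⟫ / T₄| ≤ ‖H‖ * U ^ 2 / zs := abs_ratio_le le_rfl hzs hu hw hT
  have e : ⟪u, H₂ w⟫ / (lam * T₄) - ⟪u, H w⟫ / (lam * T₄) * (⟪u, H w⟫ / (lam * T₄)) -
      (⟪φ, H₂ φ⟫ / lam - (η / lam) ^ 2) =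
      (⟪u, H₂ w⟫ / T₄ - ⟪φ, H₂ φ⟫) / lam - ((⟪u, H w⟫ / T₄) ^ 2 - η ^ 2) / lam ^ 2 := by
    field_simp
    ring
  rw [e]
  have hK1 : 0 ≤ (‖H‖ * U / zs + U ^ 2 * ‖H‖ * (2 * U) / zs ^ 2) := by positivity
  calc |(⟪u, H₂ w⟫ / T₄ - ⟪φ, H₂ φ⟫) / lam - ((⟪u, H w⟫ / T₄) ^ 2 - η ^ 2) / lam ^ 2|
      ≤ |(⟪u, H₂ w⟫ / T₄ - ⟪φ, H₂ φ⟫) / lam| + |((⟪u, H w⟫ / T₄) ^ 2 - η ^ 2) / lam ^ 2| :=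
        abs_sub _ _
    _ = |⟪u, H₂ w⟫ / T₄ - ⟪φ, H₂ φ⟫| / lam + |(⟪u, H w⟫ / T₄) ^ 2 - η ^ 2| / lam ^ 2 := by
        rw [abs_div _ lam, abs_div _ (lam ^ 2), abs_of_pos hlam, abs_of_pos (pow_pos hlam 2)]
    _ ≤ (‖H₂‖ * U / zs + U ^ 2 * ‖H₂‖ * (2 * U) / zs ^ 2) * (δu + δw) / lam +
          (|⟪u, H w⟫ / T₄| + |η|) * |⟪u, H w⟫ / T₄ - η| / lam ^ 2 := by
        gcongr
        exact abs_sq_sub_sq_le _ _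
    _ ≤ (‖H₂‖ * U / zs + U ^ 2 * ‖H₂‖ * (2 * U) / zs ^ 2) * (δu + δw) / lam +
          (‖H‖ * U ^ 2 / zs + ‖H‖) *
            ((‖H‖ * U / zs + U ^ 2 * ‖H‖ * (2 * U) / zs ^ 2) * (δu + δw)) / lam ^ 2 := by
        gcongr
    _ = _ := by ring

/-- **Summability of the bulk covariances**: `|(⟪φ, H Atᵍ H φ⟫ - ⟪φ, Hφ⟫²)/λ²| ≤ (2‖H‖²/λ²) rᵍ⁺¹`
(`r ≥ 1/2`, `H` symmetric). [folklore] -/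
theorem abs_bulkCov_le (hφ : ‖φ‖ = 1) (hr0 : 0 ≤ r) (hrhalf : 1 / 2 ≤ r)
    (hpow : ∀ (j : ℕ) (g : E), ‖(At ^ j) g - ⟪φ, g⟫ • φ‖ ≤ r ^ j * ‖g‖)
    (hH : ∀ x y : E, ⟪H x, y⟫ = ⟪x, H y⟫) {lam : ℝ} (hlam : 0 < lam) (g : ℕ) :
    |(⟪φ, H ((At ^ g) (H φ))⟫ - ⟪φ, H φ⟫ ^ 2) / lam ^ 2| ≤ 2 * ‖H‖ ^ 2 / lam ^ 2 * r ^ (g + 1) := by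
  have hrshift : r ^ g ≤ 2 * r ^ (g + 1) := by rw [pow_succ]; nlinarith [pow_nonneg hr0 g]
  have hrem := abs_inner_apply_pow_sub_le hpow (1 : E →L[ℝ] E) g (H φ) (H φ)
  simp only [one_apply_eq_self] at hrem
  have hηη : ⟪φ, H φ⟫ * ⟪H φ, φ⟫ = ⟪φ, H φ⟫ ^ 2 := by rw [real_inner_comm (H φ) φ, sq]
  rw [hηη, hH φ] at hrem
  have hHφ : ‖H φ‖ ≤ ‖H‖ := by
    calc ‖H φ‖ ≤ ‖H‖ * ‖φ‖ := H.le_opNorm φ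
      _ = ‖H‖ := by rw [hφ, mul_one]
  rw [← hH φ, abs_div, abs_of_pos (pow_pos hlam 2)]
  rw [← hH φ] at hrem
  calc |⟪H φ, (At ^ g) (H φ)⟫ - ⟪φ, H φ⟫ ^ 2| / lam ^ 2
      ≤ ‖H φ‖ * ‖(1 : E →L[ℝ] E)‖ * (r ^ g * ‖H φ‖) / lam ^ 2 := by gcongr
    _ ≤ ‖H‖ * 1 * (2 * r ^ (g + 1) * ‖H‖) / lam ^ 2 := by
        gcongr
        · exact ContinuousLinearMap.norm_id_le
    _ = 2 * ‖H‖ ^ 2 / lam ^ 2 * r ^ (g + 1) := by ring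

end Bounds

end Summit.AtomisticToContinuum.FouriersLaw.Theorems.SpecificHeatLimit

end
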